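import Summits.Ventures.LatticeQCDFlow.Scoring.ChainConfidenceInterval
import Summits.Ventures.LatticeQCDFlow.Exactness.IMHKernel
import HarnessLib

/-!
# The parity leg from the ACCEPTED CHAIN: the target mass of the exceptional set from the exact
# flow sampler's visit frequency, from any start, under a weight ceiling

HONEST FRAMING: exact (Metropolis-corrected) sampling algorithms for lattice gauge theory;
figures of merit are autocorrelation/cost numbers at stated couplings and volumes; no
continuum-physics claim.

Venture `LatticeQCDFlow` (cell pub-lqcd), topic `Scoring`; FANOUT row 4 (`s0-u1-b`, rung S0-B:
two independent codes for the 2D U(1) flow sampler).  Third part of the row's statistical leg.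
`Scoring/ParityLegConfidence.lean` and `Scoring/ParityLegConfidenceColumns.lean` certify the
exceptional-set masses of a density parity from INDEPENDENT MODEL draws (Hoeffding); their
docstrings list 'draws from the accepted chain (Markov-dependent)' as NOT CLAIMED.  This file
gives that frame for the one mass the `τ_int` column needs — the TARGET mass `π(E)` — using the
configurations the exact flow sampler actually outputs: the tree's any-start Hoeffding inequality
for a Doeblin chain (`Scoring/ChainHoeffding.chain_tail_le_exp_of_doeblin`, Poisson-martingale
route; Glynn–Ormoneit 2002 named only there) and its confidence-radius inversion
(`Scoring/ChainConfidenceInterval.chain_confidence_of_doeblin`), composed with row 30's kernel-level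
facts on the flow-MCMC kernel `Exactness.indepMH q w` (`indepMH_invariant`: `π = w·q` is
invariant; `indepMH_apply_ge`: a weight ceiling `w ≤ M` is a Doeblin minorisation
`K(x, ·) ≥ M⁻¹ π`).  NEW WORK of the cell (a composition); nothing is cited as a fact; no definition
is introduced.

## Setting (kernel language of `Exactness/IMHKernel.lean`)

`Ω` the configuration space; MODEL = a probability law `q` on `Ω` (the flow's output); TARGET
`π = w·q` with `w = dπ/dq` measurable, `0 < w ≤ M`, and `π` a probability law (so `M` is the
ceiling of the NORMALISED importance weight, the cell's `W`); `K = indepMH q w` the exact flow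
sampler; `X_0, X_1, …` its trajectory from ANY initial law `μ₀` (Mathlib's `Kernel.trajMeasure`);
`E` measurable; `F_N(E) = (1/N)·#{i < N : X_i ∈ E}` the visit frequency.

## What is proved

* `exp_neg_sq_div_mono` — bookkeeping: the Hoeffding bound `exp(−(T − a)²/b)` is monotone in
  the offset `a ≤ T` and the variance proxy `b`.
* **`targetMass_le_chainFreq_confidence`** — for every `μ₀`, `N ≥ 1` and `s` with `N s ≥ 8M`:
  `P_{μ₀}( F_N(E) + s ≤ π(E) ) ≤ exp(−(N s − 8M)²/(32 N M²))`
  (the chain theorem for `f = −1_E`, `C = 1`, `C' = 1 + π(E) ≤ 2`, `ε = 1/M`).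
* **`targetMass_le_chainFreq_confidence_level`** — for every `μ₀`, `N ≥ 1`, `0 < η ≤ 1`:
  `P_{μ₀}( F_N(E) + 8M/N + √(32 M² log(2/η)/N) < π(E) ) ≤ η`.

Reading for row 4 (value-free; no number of ours, no sealed value): the symmetric `τ_int` law of
`Exactness/IMHTauIntParityTwoSided.lean` has one unknown, the target mass `π(E)` of the set where
the two codes' densities disagree by more than `δ`; besides the model-draw estimate of
`ParityLegConfidence` (importance-weighted failures), the production chain itself certifies it:
count the accepted-chain configurations on which the other code's log-density is off by more
than `δ`, add the any-start Doeblin radius `8W/N + √(32 W² log(2/η)/N)` — no thermalisation cut,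
no autocorrelation estimate, cold or hot start alike.  NOT CLAIMED: the value of `W` for any
trained flow; sharpness of `8`, `32` (the crude `C' ≤ 2`); the model masses `q(E)`, `q'(E)` from
the chain (they are model means — use the proposals, `ParityLegConfidence`); unbounded scores;
any number re-scored.
-/

noncomputable section

namespace Summit.Ventures.LatticeQCDFlow.Scoring.ParityLeg

open MeasureTheory ProbabilityTheory Finset Set
open Summit.Ventures.LatticeQCDFlow.Exactness
open scoped ENNReal

/-! ## §1 Bookkeeping -/

/-- The Gaussian-tail bound `exp(−(T − a)²/b)` increases with the offset `a ≤ T` and with the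
variance proxy `b > 0`. -/
theorem exp_neg_sq_div_mono {T a a' b b' : ℝ} (haa : a ≤ a') (haT : a' ≤ T) (hb : 0 < b)
    (hbb : b ≤ b') :
    Real.exp (-(T - a) ^ 2 / b) ≤ Real.exp (-(T - a') ^ 2 / b') := by
  refine Real.exp_le_exp.2 ?_
  rw [neg_div, neg_div, neg_le_neg_iff]
  have h1 : (T - a') ^ 2 ≤ (T - a) ^ 2 := by nlinarith
  have hb' : 0 < b' := hb.trans_le hbb
  calc (T - a') ^ 2 / b' ≤ (T - a) ^ 2 / b' := div_le_div_of_nonneg_right h1 hb'.le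
    _ ≤ (T - a) ^ 2 / b := div_le_div_of_nonneg_left (sq_nonneg _) hb hbb

/-! ## §2 The target mass of `E` from the chain's visit frequency -/

variable {Ω : Type*} [MeasurableSpace Ω] {q : Measure Ω} [IsProbabilityMeasure q] {w : Ω → ℝ}

/-- **THE TARGET MASS OF THE EXCEPTIONAL SET FROM THE ACCEPTED CHAIN, ANY START.**  `q` a model
law, `w = dπ/dq` measurable with `0 < w ≤ M` and `π = w·q` a probability law; `K = indepMH q w` the
exact flow sampler, run from any initial law `μ₀`; `E` measurable; `N ≥ 1`; `s` with `N s ≥ 8M`.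
Then `P_{μ₀}( (1/N)·Σ_{i<N} 1_E(X_i) + s ≤ π(E) ) ≤ exp(−(N s − 8M)²/(32 N M²))`. -/
theorem targetMass_le_chainFreq_confidence (hw : Measurable w) (hw0 : ∀ x, 0 < w x) {M : ℝ}
    (hM : ∀ x, w x ≤ M) (hπ : IsProbabilityMeasure (q.withDensity fun x => ENNReal.ofReal (w x)))
    (μ₀ : Measure Ω) [IsProbabilityMeasure μ₀] {E : Set Ω} (hE : MeasurableSet E) {N : ℕ}
    (hN : N ≠ 0) {s : ℝ} (hs : 8 * M ≤ N * s) :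
    haveI : Fact (Measurable w) := ⟨hw⟩
    (Kernel.trajMeasure (X := fun _ : ℕ => Ω) μ₀
          (fun m : ℕ => (indepMH q w).comap
            (fun y : (i : ↥(Finset.Iic m)) → Ω => y ⟨m, Finset.mem_Iic.2 le_rfl⟩)
            (measurable_pi_apply _))).real
        {x | (∑ i ∈ Finset.range N, E.indicator (fun _ => (1 : ℝ)) (x i)) / N + s
            ≤ (q.withDensity fun z => ENNReal.ofReal (w z)).real E}
      ≤ Real.exp (-(N * s - 8 * M) ^ 2 / (32 * N * M ^ 2)) := by
  haveI : Fact (Measurable w) := ⟨hw⟩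
  haveI := hπ
  obtain ⟨x₀⟩ := nonempty_of_isProbabilityMeasure q
  have hM0 : 0 < M := (hw0 x₀).trans_le (hM x₀)
  set π : Measure Ω := q.withDensity fun z => ENNReal.ofReal (w z) with hπdef
  have hinv : Kernel.Invariant (indepMH q w) π := indepMH_invariant hw hw0
  set ε : ℝ≥0∞ := (ENNReal.ofReal M)⁻¹ with hεdef
  have hε0 : 0 < ε := ENNReal.inv_pos.2 ENNReal.ofReal_ne_top
  have hεr : ε.toReal = M⁻¹ := by rw [hεdef, ENNReal.toReal_inv, ENNReal.toReal_ofReal hM0.le]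
  have hmin : ∀ x {B : Set Ω}, MeasurableSet B → ε * π B ≤ indepMH q w x B :=
    fun x B hB => indepMH_apply_ge hw hw0 hM x hB
  -- the score `f = −1_E`: `|f| ≤ 1`, `πf = −π(E)`
  set f : Ω → ℝ := fun z => -(E.indicator (fun _ => (1 : ℝ)) z) with hfdef
  have hfm : Measurable f := (measurable_const.indicator hE).neg
  have hfb : ∀ z, |f z| ≤ 1 := fun z => by
    rw [hfdef]; dsimp only; rw [abs_neg]
    by_cases hz : z ∈ E
    · rw [indicator_of_mem hz, abs_one]
    · rw [indicator_of_notMem hz, abs_zero]; exact zero_le_one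
  have hπf : ∫ z, f z ∂π = -π.real E := by
    rw [hfdef, integral_neg, integral_indicator hE, setIntegral_const, smul_eq_mul, mul_one]
  have hπE1 : π.real E ≤ 1 := measureReal_le_one
  have hπE0 : 0 ≤ π.real E := measureReal_nonneg
  have habs : |∫ z, f z ∂π| = π.real E := by rw [hπf, abs_neg, abs_of_nonneg hπE0]
  have hNpos : (0 : ℝ) < N := by exact_mod_cast Nat.pos_of_ne_zero hN
  -- the chain theorem's side condition `4 C'/ε ≤ N s` from `8 M ≤ N s`
  have hs' : 4 * (1 + |∫ z, f z ∂π|) / ε.toReal ≤ N * s := by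
    rw [habs, hεr, div_inv_eq_mul]
    nlinarith
  have h := chain_tail_le_exp_of_doeblin (μ₀ := μ₀) hinv hmin hε0 hfm hfb hN hs'
  rw [habs, hεr, div_inv_eq_mul] at h
  -- our event is the chain theorem's event for `f = −1_E`
  have hset : {x : ℕ → Ω | (∑ i ∈ Finset.range N, E.indicator (fun _ => (1 : ℝ)) (x i)) / N + s
        ≤ π.real E}
      ⊆ {x | s ≤ (∑ i ∈ Finset.range N, f (x i)) / N - ∫ z, f z ∂π} := by
    intro x hx
    simp only [mem_setOf_eq] at hx ⊢
    rw [hπf, hfdef, Finset.sum_neg_distrib, neg_div]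
    linarith
  refine (measureReal_mono hset).trans (h.trans ?_)
  -- monotonicity in `C' = 1 + π(E) ≤ 2`
  have e1 : (8 : ℝ) * N * (1 + π.real E) ^ 2 / M⁻¹ ^ 2 = 8 * N * (1 + π.real E) ^ 2 * M ^ 2 := by
    rw [inv_pow, div_inv_eq_mul]
  rw [e1]
  refine exp_neg_sq_div_mono (by nlinarith) hs (by positivity) ?_
  have h4 : (1 + π.real E) ^ 2 ≤ 4 := by nlinarith
  calc 8 * (N : ℝ) * (1 + π.real E) ^ 2 * M ^ 2 = (8 * N * M ^ 2) * (1 + π.real E) ^ 2 := by ring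
    _ ≤ (8 * N * M ^ 2) * 4 := mul_le_mul_of_nonneg_left h4 (by positivity)
    _ = 32 * N * M ^ 2 := by ring

/-- **The same at a prescribed confidence level.**  For every initial law `μ₀`, `N ≥ 1` and
`0 < η ≤ 1`: `P_{μ₀}( (1/N)·Σ_{i<N} 1_E(X_i) + 8M/N + √(32 M² log(2/η)/N) < π(E) ) ≤ η`
(`chain_confidence_of_doeblin` with `C' ≤ 2`, `ε = 1/M`). -/
theorem targetMass_le_chainFreq_confidence_level (hw : Measurable w) (hw0 : ∀ x, 0 < w x)
    {M : ℝ} (hM : ∀ x, w x ≤ M)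
    (hπ : IsProbabilityMeasure (q.withDensity fun x => ENNReal.ofReal (w x)))
    (μ₀ : Measure Ω) [IsProbabilityMeasure μ₀] {E : Set Ω} (hE : MeasurableSet E) {N : ℕ}
    (hN : N ≠ 0) {η : ℝ} (hη0 : 0 < η) (hη1 : η ≤ 1) :
    haveI : Fact (Measurable w) := ⟨hw⟩
    (Kernel.trajMeasure (X := fun _ : ℕ => Ω) μ₀
          (fun m : ℕ => (indepMH q w).comap
            (fun y : (i : ↥(Finset.Iic m)) → Ω => y ⟨m, Finset.mem_Iic.2 le_rfl⟩)
            (measurable_pi_apply _))).real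
        {x | (∑ i ∈ Finset.range N, E.indicator (fun _ => (1 : ℝ)) (x i)) / N
            + 8 * M / N + Real.sqrt (32 * M ^ 2 * Real.log (2 / η) / N)
            < (q.withDensity fun z => ENNReal.ofReal (w z)).real E}
      ≤ η := by
  haveI : Fact (Measurable w) := ⟨hw⟩
  haveI := hπ
  obtain ⟨x₀⟩ := nonempty_of_isProbabilityMeasure q
  have hM0 : 0 < M := (hw0 x₀).trans_le (hM x₀)
  set π : Measure Ω := q.withDensity fun z => ENNReal.ofReal (w z) with hπdef
  have hinv : Kernel.Invariant (indepMH q w) π := indepMH_invariant hw hw0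
  set ε : ℝ≥0∞ := (ENNReal.ofReal M)⁻¹ with hεdef
  have hε0 : 0 < ε := ENNReal.inv_pos.2 ENNReal.ofReal_ne_top
  have hεr : ε.toReal = M⁻¹ := by rw [hεdef, ENNReal.toReal_inv, ENNReal.toReal_ofReal hM0.le]
  have hmin : ∀ x {B : Set Ω}, MeasurableSet B → ε * π B ≤ indepMH q w x B :=
    fun x B hB => indepMH_apply_ge hw hw0 hM x hB
  -- the score `f = 1_E`: `|f| ≤ 1`, `πf = π(E) ∈ [0, 1]`
  set f : Ω → ℝ := fun z => E.indicator (fun _ => (1 : ℝ)) z with hfdef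
  have hfm : Measurable f := measurable_const.indicator hE
  have hfb : ∀ z, |f z| ≤ 1 := fun z => by
    rw [hfdef]; dsimp only
    by_cases hz : z ∈ E
    · rw [indicator_of_mem hz, abs_one]
    · rw [indicator_of_notMem hz, abs_zero]; exact zero_le_one
  have hπf : ∫ z, f z ∂π = π.real E := by
    rw [hfdef]
    dsimp only
    rw [integral_indicator hE, setIntegral_const, smul_eq_mul, mul_one]
  have hπE1 : π.real E ≤ 1 := measureReal_le_one
  have hπE0 : 0 ≤ π.real E := measureReal_nonneg
  have habs : |∫ z, f z ∂π| = π.real E := by rw [hπf, abs_of_nonneg hπE0]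
  have hNpos : (0 : ℝ) < N := by exact_mod_cast Nat.pos_of_ne_zero hN
  have h := chain_confidence_of_doeblin (μ₀ := μ₀) hinv hmin hε0 hfm hfb hN hη0 hη1
  rw [habs, hεr, hπf] at h
  -- the chain radius with `C' = 1 + π(E)` is at most ours (`C' ≤ 2`)
  have hL : 0 ≤ Real.log (2 / η) :=
    Real.log_nonneg (by rw [le_div_iff₀ hη0]; linarith)
  have hr1 : 4 * (1 + π.real E) / (M⁻¹ * N) ≤ 8 * M / N := by
    rw [div_le_div_iff₀ (by positivity) hNpos]
    have : 4 * (1 + π.real E) * N ≤ 8 * N := by nlinarith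
    calc 4 * (1 + π.real E) * N ≤ 8 * N := this
      _ = 8 * M * (M⁻¹ * N) := by field_simp
  have hr2 : Real.sqrt (8 * (1 + π.real E) ^ 2 * Real.log (2 / η) / (M⁻¹ ^ 2 * N))
      ≤ Real.sqrt (32 * M ^ 2 * Real.log (2 / η) / N) := by
    refine Real.sqrt_le_sqrt ?_
    have e : 8 * (1 + π.real E) ^ 2 * Real.log (2 / η) / (M⁻¹ ^ 2 * N)
        = 8 * (1 + π.real E) ^ 2 * M ^ 2 * Real.log (2 / η) / N := by
      field_simp
    rw [e]
    refine div_le_div_of_nonneg_right ?_ hNpos.le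
    have h4 : (1 + π.real E) ^ 2 ≤ 4 := by nlinarith
    nlinarith [mul_nonneg (mul_nonneg (sub_nonneg.2 h4) (sq_nonneg M)) hL]
  refine (measureReal_mono fun x hx => ?_).trans h
  simp only [mem_setOf_eq] at hx ⊢
  have hlt : (∑ i ∈ Finset.range N, f (x i)) / N
      + (4 * (1 + π.real E) / (M⁻¹ * N)
        + Real.sqrt (8 * (1 + π.real E) ^ 2 * Real.log (2 / η) / (M⁻¹ ^ 2 * N))) < π.real E := by
    rw [hfdef]
    linarith
  rw [lt_abs]
  right
  linarith

end Summit.Ventures.LatticeQCDFlow.Scoring.ParityLeg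

end
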